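import Summits.CriticalPhenomena.PercolationContinuityZ3.Theses.PercShatteringRace
import Summits.CriticalPhenomena.PercolationContinuityZ3.Theses.PercAnnulusCrossing
import Summits.CriticalPhenomena.PercolationContinuityZ3.Theses.PercFiniteBoxLRO
import Summits.CriticalPhenomena.PercolationContinuityZ3.Theorems.PercShatteringRaceNearLinearTwoClusterDecayStubPeelInclusion
import Summits.CriticalPhenomena.PercolationContinuityZ3.Theorems.PercShatteringRaceNearLinearTwoClusterDecayStubShellIndependence
import Literature.Probability.Percolation.SharpnessDCTProofs

/-!
# `NearLinearTwoClusterDecay` (stmt-CriticalPhenomena-5785): the crux REDUCED to bounded-aspect shell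
# two-cluster non-certainty (line `critical-orange-peeling`, certified composition)

Route `PercShatteringRace`, crux `U(1/6)` = `NearLinearTwoClusterDecay`: at `p_c` (bond, `ℤ³`) the
probability that `Λ(⌈n^{7/6}⌉)` contains two in-box-distinct open clusters both joining `Λ(n)` to
`∂ⁱⁿΛ(⌈n^{7/6}⌉)` tends to `0`.

This file lands the COMPOSITION of the lead's skeleton
(`Cruxes/NearLinearTwoClusterDecay/Lines/critical_orange_peeling.lean`, rev 2) as honest theorems,
with the single open stub as an explicit hypothesis:

* `NearLinearTwoClusterDecayPeelChain.tendsto_of_peelChain` — the ABSTRACT orange-peeling lemma: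
  for real arrays `a n m ∈ [0,1]` ("two-cluster probability of `(Λ(n), Λ(m))`") and
  `s m m' ∈ [0,1]` ("shell two-cluster probability of `Λ(m') ∖ Λ(m)`") with the one-skin peel
  `a n m' ≤ a n m · s m m'` (`n ≤ m < m'`), ONE `ε`-good skin (`s ≤ 1 - ε`) in every window of `L`
  consecutive skins of every geometric chain `M^ℓ N` (`N` large) forces `a n ⌈n^α⌉ → 0` for EVERY
  `α > 1` (block induction `a n (M^{bL} n) ≤ (1-ε)^b`, then `M^{bL} n ≤ ⌈n^α⌉` eventually).
* `real_twoCluster_peel` — the concrete peel inequality at every `p`: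
  `P_p(A₂(n, m')) ≤ P_p(A₂(n, m)) · P_p(Sh(m, m'))`, `n ≤ m < m'`, from the two LANDED stubs
  `stub_peelInclusion` (path surgery, a.s. lattice configurations) and `stub_shellIndependence`
  (disjoint pair sets).
* `nearLinearTwoClusterDecay_of_shellNonCertainty` — **stub 3 ⇒ the crux BY NAME**;
  `critBoxTwoArmsDecay_of_shellNonCertainty` — stub 3 ⇒ `PercFiniteBoxLRO.CritBoxTwoArmsDecay`
  (stmt-CriticalPhenomena-0859, `U(b)` for every `b > 0`).
* `nearLinearTwoClusterDecay_of_critAnnulusNonCrossing`, `critBoxTwoArmsDecay_of_critAnnulusNonCrossing`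
  — certified inter-route edges: `PercAnnulusCrossing.CritAnnulusNonCrossing`
  (stmt-CriticalPhenomena-0846) implies stub 3 (`M = 3`, `L = 1`: a shell crossing of
  `Λ(3N) ∖ Λ(N)` contains an annulus crossing `Λ(N+1) → ∂ⁱⁿΛ(2(N+1))`), hence both cruxes.

Stub 3 (`ShellNonCertainty`, spelled inline below; OPEN — the entire `d < 6` content of the line,
false for `d ≥ 7`): `∃ M ≥ 2, ∃ ε > 0, ∃ L, ∀ᶠ N, ∃ ℓ < L, P_{p_c}(Sh(M^ℓ N, M^{ℓ+1} N)) ≤ 1 - ε`,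
where `Sh(R, R')` = "the configuration restricted to the shell `Λ(R') ∖ Λ(R)` has two shell-distinct
open clusters, each joining the inner layer `Λ(R+1) ∖ Λ(R)` to `∂ⁱⁿΛ(R')`".

References: G. Grimmett, *Percolation* (1999), §7.4 Lemma (7.89) (supercritical orange peeling —
here transplanted to `p_c` with geometric skins); the crux protocol files of stmt-5785.
-/

noncomputable section

open MeasureTheory Filter
open scoped Topology
open Literature.Probability.Percolation Literature.Probability.LatticeModels

namespace Summit.CriticalPhenomena.PercolationContinuityZ3.Theorems

namespace NearLinearTwoClusterDecayPeelChain

/-! ## The abstract orange-peeling lemma -/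

section Abstract

variable {a s : ℕ → ℕ → ℝ}

/-- **Antitonicity in the outer radius from the peel**: `a n m' ≤ a n m` for `n ≤ m ≤ m'`. -/
theorem antitone_of_peel (ha0 : ∀ n m, 0 ≤ a n m) (hs1 : ∀ m m', s m m' ≤ 1)
    (hpeel : ∀ n m m', n ≤ m → m < m' → a n m' ≤ a n m * s m m')
    {n m m' : ℕ} (hnm : n ≤ m) (hmm' : m ≤ m') : a n m' ≤ a n m := by
  rcases hmm'.eq_or_lt with rfl | hlt
  · exact le_rfl
  · calc a n m' ≤ a n m * s m m' := hpeel n m m' hnm hlt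
      _ ≤ a n m * 1 := mul_le_mul_of_nonneg_left (hs1 m m') (ha0 n m)
      _ = a n m := mul_one _

/-- Radii of the geometric chain increase strictly: `M^k n < M^(k+1) n` for `M ≥ 2`, `n ≥ 1`. -/
theorem chain_lt {M n : ℕ} (hM : 2 ≤ M) (hn : 1 ≤ n) (k : ℕ) : M ^ k * n < M ^ (k + 1) * n := by
  have hx : 0 < M ^ k * n := Nat.mul_pos (pow_pos (by omega) k) (by omega)
  calc M ^ k * n < 2 * (M ^ k * n) := by omega
    _ ≤ M * (M ^ k * n) := Nat.mul_le_mul_right _ hM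
    _ = M ^ (k + 1) * n := by ring

/-- Radii of the geometric chain dominate the inner radius: `n ≤ M^k n` for `M ≥ 2`. -/
theorem le_chain {M : ℕ} (hM : 2 ≤ M) (n k : ℕ) : n ≤ M ^ k * n :=
  Nat.le_mul_of_pos_left n (pow_pos (by omega) k)

/-- Radii of the geometric chain are monotone in the exponent. -/
theorem chain_mono {M : ℕ} (hM : 2 ≤ M) (n : ℕ) {k t : ℕ} (hkt : k ≤ t) : M ^ k * n ≤ M ^ t * n :=
  Nat.mul_le_mul_right n (pow_le_pow_right₀ (by omega) hkt)

/-- **Block induction along the geometric chain**: one `ε`-good skin per window of `L` skins above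
every `N ≥ N₀` gives `a n (M^{bL} n) ≤ (1 - ε)^b` for `n ≥ max N₀ 1`. -/
theorem chain_le (ha0 : ∀ n m, 0 ≤ a n m) (ha1 : ∀ n m, a n m ≤ 1) (hs0 : ∀ m m', 0 ≤ s m m')
    (hs1 : ∀ m m', s m m' ≤ 1) (hpeel : ∀ n m m', n ≤ m → m < m' → a n m' ≤ a n m * s m m')
    {M : ℕ} (hM : 2 ≤ M) {ε : ℝ} {L N₀ : ℕ}
    (hgood : ∀ N : ℕ, N₀ ≤ N → ∃ ℓ < L, s (M ^ ℓ * N) (M ^ (ℓ + 1) * N) ≤ 1 - ε)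
    {n : ℕ} (hn : N₀ ≤ n) (hn1 : 1 ≤ n) :
    ∀ b : ℕ, a n (M ^ (b * L) * n) ≤ (1 - ε) ^ b := by
  intro b
  induction b with
  | zero => rw [zero_mul, pow_zero, one_mul, pow_zero]; exact ha1 n n
  | succ b ih =>
    obtain ⟨ℓ, hℓ, hP⟩ := hgood (M ^ (b * L) * n) (hn.trans (le_chain hM n _))
    have e1 : M ^ ℓ * (M ^ (b * L) * n) = M ^ (b * L + ℓ) * n := by ring
    have e2 : M ^ (ℓ + 1) * (M ^ (b * L) * n) = M ^ (b * L + ℓ + 1) * n := by ring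
    rw [e1, e2] at hP
    have h0ε : 0 ≤ 1 - ε := (hs0 _ _).trans hP
    have hidx : b * L + ℓ + 1 ≤ (b + 1) * L := by nlinarith
    calc a n (M ^ ((b + 1) * L) * n)
        ≤ a n (M ^ (b * L + ℓ + 1) * n) :=
          antitone_of_peel ha0 hs1 hpeel (le_chain hM n _) (chain_mono hM n hidx)
      _ ≤ a n (M ^ (b * L + ℓ) * n) * s (M ^ (b * L + ℓ) * n) (M ^ (b * L + ℓ + 1) * n) :=
          hpeel _ _ _ (le_chain hM n _) (chain_lt hM hn1 _)
      _ ≤ a n (M ^ (b * L) * n) * (1 - ε) :=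
          mul_le_mul (antitone_of_peel ha0 hs1 hpeel (le_chain hM n _)
            (chain_mono hM n (Nat.le_add_right _ _))) hP (hs0 _ _) (ha0 _ _)
      _ ≤ (1 - ε) ^ b * (1 - ε) := mul_le_mul_of_nonneg_right ih h0ε
      _ = (1 - ε) ^ (b + 1) := (pow_succ _ _).symm

/-- **Scale arithmetic**: for every `α > 1` and every `A`, eventually `A · n ≤ ⌈n^α⌉₊`. -/
theorem eventually_mul_le_ceil_rpow (A : ℕ) {α : ℝ} (hα : 1 < α) :
    ∀ᶠ n : ℕ in atTop, A * n ≤ ⌈(n : ℝ) ^ α⌉₊ := by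
  have ht : Tendsto (fun n : ℕ => (n : ℝ) ^ (α - 1)) atTop atTop :=
    (tendsto_rpow_atTop (by linarith : 0 < α - 1)).comp tendsto_natCast_atTop_atTop
  filter_upwards [ht.eventually_ge_atTop (A : ℝ), eventually_ge_atTop 1] with n hn hn1
  have hn0 : (0 : ℝ) < n := by exact_mod_cast hn1
  have h2 : (A : ℝ) * n ≤ (n : ℝ) ^ α := by
    calc (A : ℝ) * n ≤ (n : ℝ) ^ (α - 1) * n := mul_le_mul_of_nonneg_right hn hn0.le
      _ = (n : ℝ) ^ (α - 1) * (n : ℝ) ^ (1 : ℝ) := by rw [Real.rpow_one]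
      _ = (n : ℝ) ^ α := by rw [← Real.rpow_add hn0]; ring_nf
  have h3 : ((A * n : ℕ) : ℝ) ≤ ((⌈(n : ℝ) ^ α⌉₊ : ℕ) : ℝ) := by
    push_cast
    exact h2.trans (Nat.le_ceil _)
  exact_mod_cast h3

/-- **The abstract orange-peeling lemma**: peel + one `ε`-good skin per window of `L` skins of
every geometric chain above large `N` ⇒ `a n ⌈n^α⌉ → 0` for every `α > 1`. -/
theorem tendsto_of_peelChain (ha0 : ∀ n m, 0 ≤ a n m) (ha1 : ∀ n m, a n m ≤ 1)
    (hs0 : ∀ m m', 0 ≤ s m m') (hs1 : ∀ m m', s m m' ≤ 1)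
    (hpeel : ∀ n m m', n ≤ m → m < m' → a n m' ≤ a n m * s m m')
    {M : ℕ} (hM : 2 ≤ M) {ε : ℝ} (hε : 0 < ε) {L : ℕ}
    (hgood : ∀ᶠ N : ℕ in atTop, ∃ ℓ < L, s (M ^ ℓ * N) (M ^ (ℓ + 1) * N) ≤ 1 - ε)
    {α : ℝ} (hα : 1 < α) :
    Tendsto (fun n : ℕ => a n ⌈(n : ℝ) ^ α⌉₊) atTop (𝓝 0) := by
  obtain ⟨N₀, hN₀⟩ := eventually_atTop.1 hgood
  have h1ε : 1 - ε < 1 := by linarith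
  have h0ε : 0 ≤ 1 - ε := by
    obtain ⟨ℓ, -, hℓ⟩ := hN₀ N₀ le_rfl
    exact (hs0 _ _).trans hℓ
  rw [Metric.tendsto_atTop]
  intro δ hδ
  obtain ⟨b, hb⟩ := exists_pow_lt_of_lt_one hδ h1ε
  obtain ⟨N₁, hN₁⟩ := eventually_atTop.1 (eventually_mul_le_ceil_rpow (M ^ (b * L)) hα)
  refine ⟨max (max N₀ 1) N₁, fun n hn => ?_⟩
  have hnN₀ : N₀ ≤ n := le_trans (le_max_left _ _) (le_trans (le_max_left _ _) hn)
  have hn1 : 1 ≤ n := le_trans (le_max_right _ _) (le_trans (le_max_left _ _) hn)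
  have hnN₁ : N₁ ≤ n := le_trans (le_max_right _ _) hn
  rw [Real.dist_0_eq_abs, abs_of_nonneg (ha0 _ _)]
  calc a n ⌈(n : ℝ) ^ α⌉₊
      ≤ a n (M ^ (b * L) * n) := antitone_of_peel ha0 hs1 hpeel (le_chain hM n _) (hN₁ n hnN₁)
    _ ≤ (1 - ε) ^ b := chain_le ha0 ha1 hs0 hs1 hpeel hM hN₀ hnN₀ hn1 b
    _ < δ := hb

end Abstract

/-! ## The concrete peel at every edge density `p` (stubs 1 and 2, landed) -/

/-- **One skin peeled**, every `p`: `P_p(A₂(n, m')) ≤ P_p(A₂(n, m)) · P_p(Sh(m, m'))` for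
`n ≤ m < m'` — `stub_peelInclusion` on the full-measure set of lattice configurations
(`DCT16.real_mono_of_forall_subset_edgeSet`), then `stub_shellIndependence`. -/
theorem real_twoCluster_peel (p : unitInterval) {n m m' : ℕ} (hnm : n ≤ m) (hmm' : m < m') :
    (bondPercolation (zdGraph 3) p).real
        {ω | ∃ x ∈ box 3 n, ∃ x' ∈ box 3 n, ∃ y ∈ innerBoundary (zdGraph 3) (box 3 m'),
          ∃ y' ∈ innerBoundary (zdGraph 3) (box 3 m'),
            ω ∈ openConnIn (↑(box 3 m') : Set (Site 3)) x y ∧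
            ω ∈ openConnIn (↑(box 3 m') : Set (Site 3)) x' y' ∧
            ω ∉ openConnIn (↑(box 3 m') : Set (Site 3)) x x'} ≤
      (bondPercolation (zdGraph 3) p).real
          {ω | ∃ x ∈ box 3 n, ∃ x' ∈ box 3 n, ∃ y ∈ innerBoundary (zdGraph 3) (box 3 m),
            ∃ y' ∈ innerBoundary (zdGraph 3) (box 3 m),
              ω ∈ openConnIn (↑(box 3 m) : Set (Site 3)) x y ∧
              ω ∈ openConnIn (↑(box 3 m) : Set (Site 3)) x' y' ∧
              ω ∉ openConnIn (↑(box 3 m) : Set (Site 3)) x x'} *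
        (bondPercolation (zdGraph 3) p).real
          {ω | ∃ u ∈ (↑(box 3 (m + 1)) : Set (Site 3)) \ ↑(box 3 m),
            ∃ u' ∈ (↑(box 3 (m + 1)) : Set (Site 3)) \ ↑(box 3 m),
            ∃ v ∈ innerBoundary (zdGraph 3) (box 3 m'),
            ∃ v' ∈ innerBoundary (zdGraph 3) (box 3 m'),
              ω ∈ openConnIn ((↑(box 3 m') : Set (Site 3)) \ ↑(box 3 m)) u v ∧
              ω ∈ openConnIn ((↑(box 3 m') : Set (Site 3)) \ ↑(box 3 m)) u' v' ∧
              ω ∉ openConnIn ((↑(box 3 m') : Set (Site 3)) \ ↑(box 3 m)) u u'} := by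
  refine le_trans ?_ (stub_shellIndependence p n m m')
  exact DCT16.real_mono_of_forall_subset_edgeSet (zdGraph 3) p
    fun ω hω h => stub_peelInclusion n m m' hnm hmm' ω hω h

/-- **Two-cluster decay at every aspect exponent from shell non-certainty** (every `p`; the
statement is used at `p = p_c`): if for some `M ≥ 2`, `ε > 0`, `L`, eventually every window of `L`
consecutive skins of the geometric chain above `N` contains a skin `Sh(M^ℓ N, M^{ℓ+1} N)` of
`P_p`-probability `≤ 1 - ε`, then `P_p(A₂(n, ⌈n^α⌉)) → 0` for every `α > 1`. -/
theorem tendsto_real_twoCluster_of_shellNonCertainty (p : unitInterval)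
    (h : ∃ M : ℕ, 2 ≤ M ∧ ∃ ε : ℝ, 0 < ε ∧ ∃ L : ℕ, ∀ᶠ N : ℕ in atTop, ∃ ℓ < L,
      (bondPercolation (zdGraph 3) p).real
          {ω | ∃ u ∈ (↑(box 3 (M ^ ℓ * N + 1)) : Set (Site 3)) \ ↑(box 3 (M ^ ℓ * N)),
            ∃ u' ∈ (↑(box 3 (M ^ ℓ * N + 1)) : Set (Site 3)) \ ↑(box 3 (M ^ ℓ * N)),
            ∃ v ∈ innerBoundary (zdGraph 3) (box 3 (M ^ (ℓ + 1) * N)),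
            ∃ v' ∈ innerBoundary (zdGraph 3) (box 3 (M ^ (ℓ + 1) * N)),
              ω ∈ openConnIn ((↑(box 3 (M ^ (ℓ + 1) * N)) : Set (Site 3)) \ ↑(box 3 (M ^ ℓ * N))) u v ∧
              ω ∈ openConnIn ((↑(box 3 (M ^ (ℓ + 1) * N)) : Set (Site 3)) \ ↑(box 3 (M ^ ℓ * N))) u' v' ∧
              ω ∉ openConnIn ((↑(box 3 (M ^ (ℓ + 1) * N)) : Set (Site 3)) \ ↑(box 3 (M ^ ℓ * N))) u u'}
        ≤ 1 - ε)
    {α : ℝ} (hα : 1 < α) :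
    Tendsto (fun n : ℕ => (bondPercolation (zdGraph 3) p).real
      {ω | ∃ x ∈ box 3 n, ∃ x' ∈ box 3 n, ∃ y ∈ innerBoundary (zdGraph 3) (box 3 ⌈(n : ℝ) ^ α⌉₊),
        ∃ y' ∈ innerBoundary (zdGraph 3) (box 3 ⌈(n : ℝ) ^ α⌉₊),
          ω ∈ openConnIn (↑(box 3 ⌈(n : ℝ) ^ α⌉₊) : Set (Site 3)) x y ∧
          ω ∈ openConnIn (↑(box 3 ⌈(n : ℝ) ^ α⌉₊) : Set (Site 3)) x' y' ∧
          ω ∉ openConnIn (↑(box 3 ⌈(n : ℝ) ^ α⌉₊) : Set (Site 3)) x x'}) atTop (𝓝 0) := by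
  obtain ⟨M, hM, ε, hε, L, hgood⟩ := h
  -- the two arrays of the abstract lemma
  set a : ℕ → ℕ → ℝ := fun n m => (bondPercolation (zdGraph 3) p).real
      {ω | ∃ x ∈ box 3 n, ∃ x' ∈ box 3 n, ∃ y ∈ innerBoundary (zdGraph 3) (box 3 m),
        ∃ y' ∈ innerBoundary (zdGraph 3) (box 3 m),
          ω ∈ openConnIn (↑(box 3 m) : Set (Site 3)) x y ∧
          ω ∈ openConnIn (↑(box 3 m) : Set (Site 3)) x' y' ∧
          ω ∉ openConnIn (↑(box 3 m) : Set (Site 3)) x x'} with ha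
  set s : ℕ → ℕ → ℝ := fun m m' => (bondPercolation (zdGraph 3) p).real
      {ω | ∃ u ∈ (↑(box 3 (m + 1)) : Set (Site 3)) \ ↑(box 3 m),
        ∃ u' ∈ (↑(box 3 (m + 1)) : Set (Site 3)) \ ↑(box 3 m),
        ∃ v ∈ innerBoundary (zdGraph 3) (box 3 m'),
        ∃ v' ∈ innerBoundary (zdGraph 3) (box 3 m'),
          ω ∈ openConnIn ((↑(box 3 m') : Set (Site 3)) \ ↑(box 3 m)) u v ∧
          ω ∈ openConnIn ((↑(box 3 m') : Set (Site 3)) \ ↑(box 3 m)) u' v' ∧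
          ω ∉ openConnIn ((↑(box 3 m') : Set (Site 3)) \ ↑(box 3 m)) u u'} with hs
  have key := tendsto_of_peelChain (a := a) (s := s) (fun _ _ => measureReal_nonneg)
    (fun _ _ => measureReal_le_one) (fun _ _ => measureReal_nonneg) (fun _ _ => measureReal_le_one)
    (fun n m m' hnm hmm' => real_twoCluster_peel p hnm hmm') hM hε (L := L) hgood hα
  exact key

end NearLinearTwoClusterDecayPeelChain

open NearLinearTwoClusterDecayPeelChain

/-! ## Stub 3 ⇒ the crux (by name) and ⇒ `CritBoxTwoArmsDecay` -/

/-- **`NearLinearTwoClusterDecay` from bounded-aspect shell two-cluster non-certainty at `p_c`**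
(the line `critical-orange-peeling` closed modulo its single open stub, stated here inline as the
hypothesis): the crux `U(1/6)` of route `PercShatteringRace` is the instance `α = 7/6`. -/
theorem nearLinearTwoClusterDecay_of_shellNonCertainty
    (h : ∃ M : ℕ, 2 ≤ M ∧ ∃ ε : ℝ, 0 < ε ∧ ∃ L : ℕ, ∀ᶠ N : ℕ in atTop, ∃ ℓ < L,
      (bondPercolation (zdGraph 3) (criticalProbI 3)).real
          {ω | ∃ u ∈ (↑(box 3 (M ^ ℓ * N + 1)) : Set (Site 3)) \ ↑(box 3 (M ^ ℓ * N)),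
            ∃ u' ∈ (↑(box 3 (M ^ ℓ * N + 1)) : Set (Site 3)) \ ↑(box 3 (M ^ ℓ * N)),
            ∃ v ∈ innerBoundary (zdGraph 3) (box 3 (M ^ (ℓ + 1) * N)),
            ∃ v' ∈ innerBoundary (zdGraph 3) (box 3 (M ^ (ℓ + 1) * N)),
              ω ∈ openConnIn ((↑(box 3 (M ^ (ℓ + 1) * N)) : Set (Site 3)) \ ↑(box 3 (M ^ ℓ * N))) u v ∧
              ω ∈ openConnIn ((↑(box 3 (M ^ (ℓ + 1) * N)) : Set (Site 3)) \ ↑(box 3 (M ^ ℓ * N))) u' v' ∧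
              ω ∉ openConnIn ((↑(box 3 (M ^ (ℓ + 1) * N)) : Set (Site 3)) \ ↑(box 3 (M ^ ℓ * N))) u u'}
        ≤ 1 - ε) :
    Summit.CriticalPhenomena.PercolationContinuityZ3.Theses.PercShatteringRace.NearLinearTwoClusterDecay :=
  tendsto_real_twoCluster_of_shellNonCertainty (criticalProbI 3) h (by norm_num)

/-- **`PercFiniteBoxLRO.CritBoxTwoArmsDecay` (stmt-CriticalPhenomena-0859) from the same
hypothesis**: two-cluster decay at EVERY aspect exponent `α > 1`, i.e. `U(b)` for all `b > 0`. -/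
theorem critBoxTwoArmsDecay_of_shellNonCertainty
    (h : ∃ M : ℕ, 2 ≤ M ∧ ∃ ε : ℝ, 0 < ε ∧ ∃ L : ℕ, ∀ᶠ N : ℕ in atTop, ∃ ℓ < L,
      (bondPercolation (zdGraph 3) (criticalProbI 3)).real
          {ω | ∃ u ∈ (↑(box 3 (M ^ ℓ * N + 1)) : Set (Site 3)) \ ↑(box 3 (M ^ ℓ * N)),
            ∃ u' ∈ (↑(box 3 (M ^ ℓ * N + 1)) : Set (Site 3)) \ ↑(box 3 (M ^ ℓ * N)),
            ∃ v ∈ innerBoundary (zdGraph 3) (box 3 (M ^ (ℓ + 1) * N)),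
            ∃ v' ∈ innerBoundary (zdGraph 3) (box 3 (M ^ (ℓ + 1) * N)),
              ω ∈ openConnIn ((↑(box 3 (M ^ (ℓ + 1) * N)) : Set (Site 3)) \ ↑(box 3 (M ^ ℓ * N))) u v ∧
              ω ∈ openConnIn ((↑(box 3 (M ^ (ℓ + 1) * N)) : Set (Site 3)) \ ↑(box 3 (M ^ ℓ * N))) u' v' ∧
              ω ∉ openConnIn ((↑(box 3 (M ^ (ℓ + 1) * N)) : Set (Site 3)) \ ↑(box 3 (M ^ ℓ * N))) u u'}
        ≤ 1 - ε) :
    Summit.CriticalPhenomena.PercolationContinuityZ3.Theses.PercFiniteBoxLRO.CritBoxTwoArmsDecay :=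
  fun _ hα => tendsto_real_twoCluster_of_shellNonCertainty (criticalProbI 3) h hα

/-! ## The certified edge from `PercAnnulusCrossing.CritAnnulusNonCrossing` (stmt-CriticalPhenomena-0846) -/

/-- **Shell crossings contain annulus crossings**: for `2(N+1) < M N` and a lattice configuration,
an open path inside the shell `Λ(M N) ∖ Λ(N)` from the inner layer to `∂ⁱⁿΛ(M N)` contains (first
exit from `Λ(2(N+1))`) an open path inside `Λ(2(N+1))` from `Λ(N+1)` to `∂ⁱⁿΛ(2(N+1))`. -/
theorem exists_annulusCrossing_of_shellCrossing {M N : ℕ} (hMN : 2 * (N + 1) < M * N)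
    {ω : BondConfig (Site 3)} (hω : ω ⊆ (zdGraph 3).edgeSet) {u v : Site 3}
    (hu : u ∈ (↑(box 3 (N + 1)) : Set (Site 3)) \ ↑(box 3 N))
    (hv : v ∈ innerBoundary (zdGraph 3) (box 3 (M * N)))
    (huv : ω ∈ openConnIn ((↑(box 3 (M * N)) : Set (Site 3)) \ ↑(box 3 N)) u v) :
    ∃ x ∈ box 3 (N + 1), ∃ y ∈ innerBoundary (zdGraph 3) (box 3 (2 * (N + 1))),
      ω ∈ openConnIn (↑(box 3 (2 * (N + 1))) : Set (Site 3)) x y := by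
  have hu1 : u ∈ box 3 (N + 1) := Finset.mem_coe.1 hu.1
  have huR : u ∈ (↑(box 3 (2 * (N + 1))) : Set (Site 3)) :=
    Finset.mem_coe.2 (box_mono 3 (by omega) hu1)
  have hvR : v ∉ (↑(box 3 (2 * (N + 1))) : Set (Site 3)) := fun hcon =>
    DCT16.notMem_box_of_mem_innerBoundary_box hMN hv (Finset.mem_coe.1 hcon)
  obtain ⟨a, b, haR, hbR, -, hadj, hpa⟩ := (DCT16.mem_openConnIn_iff_pathIn.1 huv).exit huR hvR
  refine ⟨u, hu1, a, ?_, ?_⟩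
  · rw [mem_innerBoundary_iff]
    exact ⟨Finset.mem_coe.1 haR, b, fun hb => hbR (Finset.mem_coe.2 hb),
      DCT16.adj_of_openGraph_adj hω hadj⟩
  · exact DCT16.mem_openConnIn_iff_pathIn.2 (hpa.mono Set.inter_subset_left)

/-- **`CritAnnulusNonCrossing` ⇒ shell non-certainty** with `M = 3`, `L = 1` and the same constant:
for `N ≥ 3` the shell two-cluster event of `Λ(3N) ∖ Λ(N)` is contained (a.s.) in the annulus
crossing event `Λ(N+1) ↔ ∂ⁱⁿΛ(2(N+1))` inside `Λ(2(N+1))`. -/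
theorem shellNonCertainty_of_critAnnulusNonCrossing
    (h : Summit.CriticalPhenomena.PercolationContinuityZ3.Theses.PercAnnulusCrossing.CritAnnulusNonCrossing) :
    ∃ M : ℕ, 2 ≤ M ∧ ∃ ε : ℝ, 0 < ε ∧ ∃ L : ℕ, ∀ᶠ N : ℕ in atTop, ∃ ℓ < L,
      (bondPercolation (zdGraph 3) (criticalProbI 3)).real
          {ω | ∃ u ∈ (↑(box 3 (M ^ ℓ * N + 1)) : Set (Site 3)) \ ↑(box 3 (M ^ ℓ * N)),
            ∃ u' ∈ (↑(box 3 (M ^ ℓ * N + 1)) : Set (Site 3)) \ ↑(box 3 (M ^ ℓ * N)),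
            ∃ v ∈ innerBoundary (zdGraph 3) (box 3 (M ^ (ℓ + 1) * N)),
            ∃ v' ∈ innerBoundary (zdGraph 3) (box 3 (M ^ (ℓ + 1) * N)),
              ω ∈ openConnIn ((↑(box 3 (M ^ (ℓ + 1) * N)) : Set (Site 3)) \ ↑(box 3 (M ^ ℓ * N))) u v ∧
              ω ∈ openConnIn ((↑(box 3 (M ^ (ℓ + 1) * N)) : Set (Site 3)) \ ↑(box 3 (M ^ ℓ * N))) u' v' ∧
              ω ∉ openConnIn ((↑(box 3 (M ^ (ℓ + 1) * N)) : Set (Site 3)) \ ↑(box 3 (M ^ ℓ * N))) u u'}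
        ≤ 1 - ε := by
  obtain ⟨c, hc, hB⟩ := h
  refine ⟨3, by norm_num, c, hc, 1, ?_⟩
  filter_upwards [eventually_ge_atTop 3] with N hN
  refine ⟨0, Nat.one_pos, ?_⟩
  have hMN : 2 * (N + 1) < 3 * N := by omega
  have e0 : 3 ^ 0 * N = N := by ring
  have e1 : 3 ^ (0 + 1) * N = 3 * N := by ring
  rw [e0, e1]
  calc (bondPercolation (zdGraph 3) (criticalProbI 3)).real
        {ω | ∃ u ∈ (↑(box 3 (N + 1)) : Set (Site 3)) \ ↑(box 3 N),
            ∃ u' ∈ (↑(box 3 (N + 1)) : Set (Site 3)) \ ↑(box 3 N),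
            ∃ v ∈ innerBoundary (zdGraph 3) (box 3 (3 * N)),
            ∃ v' ∈ innerBoundary (zdGraph 3) (box 3 (3 * N)),
              ω ∈ openConnIn ((↑(box 3 (3 * N)) : Set (Site 3)) \ ↑(box 3 N)) u v ∧
              ω ∈ openConnIn ((↑(box 3 (3 * N)) : Set (Site 3)) \ ↑(box 3 N)) u' v' ∧
              ω ∉ openConnIn ((↑(box 3 (3 * N)) : Set (Site 3)) \ ↑(box 3 N)) u u'}
      ≤ (bondPercolation (zdGraph 3) (criticalProbI 3)).real
          {ω | ∃ x ∈ box 3 (N + 1), ∃ y ∈ innerBoundary (zdGraph 3) (box 3 (2 * (N + 1))),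
            ω ∈ openConnIn (↑(box 3 (2 * (N + 1))) : Set (Site 3)) x y} :=
        DCT16.real_mono_of_forall_subset_edgeSet (zdGraph 3) (criticalProbI 3)
          fun ω hω ⟨u, hu, _, _, v, hv, _, _, huv, _, _⟩ =>
            exists_annulusCrossing_of_shellCrossing hMN hω hu hv huv
    _ ≤ 1 - c := hB (N + 1) (by omega)

/-- **Inter-route edge (certified)**: `PercAnnulusCrossing.CritAnnulusNonCrossing`
(stmt-CriticalPhenomena-0846) implies the crux `NearLinearTwoClusterDecay` (stmt-CriticalPhenomena-5785). -/
theorem nearLinearTwoClusterDecay_of_critAnnulusNonCrossing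
    (h : Summit.CriticalPhenomena.PercolationContinuityZ3.Theses.PercAnnulusCrossing.CritAnnulusNonCrossing) :
    Summit.CriticalPhenomena.PercolationContinuityZ3.Theses.PercShatteringRace.NearLinearTwoClusterDecay :=
  nearLinearTwoClusterDecay_of_shellNonCertainty (shellNonCertainty_of_critAnnulusNonCrossing h)

/-- **Inter-route edge (certified)**: `PercAnnulusCrossing.CritAnnulusNonCrossing`
(stmt-CriticalPhenomena-0846) implies `PercFiniteBoxLRO.CritBoxTwoArmsDecay` (stmt-CriticalPhenomena-0859). -/
theorem critBoxTwoArmsDecay_of_critAnnulusNonCrossing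
    (h : Summit.CriticalPhenomena.PercolationContinuityZ3.Theses.PercAnnulusCrossing.CritAnnulusNonCrossing) :
    Summit.CriticalPhenomena.PercolationContinuityZ3.Theses.PercFiniteBoxLRO.CritBoxTwoArmsDecay :=
  critBoxTwoArmsDecay_of_shellNonCertainty (shellNonCertainty_of_critAnnulusNonCrossing h)

end Summit.CriticalPhenomena.PercolationContinuityZ3.Theorems

end
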